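import Literature.AlgebraicGeometry.Modules.EquivariantStructureRestrict
import HarnessLib

/-!
# Restriction of `G`-linearisations along an equivariant morphism, II: intertwiners and the canonical linearisation of an inverse image

Layer `Literature/AlgebraicGeometry/Modules`, namespace `Literature.AlgebraicGeometry.RelativeSpec` (sequel to
`Modules/EquivariantStructureRestrict`). THEOREMS plus one plumbing `abbrev` (`ActionOver.compBase`, the same automorphisms
viewed over a composite base); no named fact, no instance, no notation. Cell `hodgecm-mathlib` (D-0151), M1PRIME-DAG rung 0,
J0a junction, leaf (J0a-3b) kit (B-p07 lineage): the `rigid` clause `(ε × 1)^*𝒫 ≅ 𝒪_Â` of the dual pair of `dualOf A Θ`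
([MumfordAV1970] §8: `𝒫|_{{0} × X̂}` trivial) is obtained by restricting descent data along the slice `{0} × A → {0} × Â`
and invoking uniqueness of descent (★ `RelativeSpec/EquivariantModuleDescentUnique`); this file supplies the three
compatibilities of `restrictAlong` (★ part I) that the argument uses. Banked capital; HC_CM is proved only modulo the 7
printed citations until rung 0 closes.

* `restrictAlong_conj`, `ActionOver.EquivariantStructure.restrict_ofIso_iso_hom` — restriction commutes with conjugation
  by an isomorphism of modules (an intertwiner restricts to an intertwiner);
* `ofPullback_iso_hom_app_unitSection` — the canonical linearisation `ofPullback ρ F` of `q^* F` on pulled-back sections;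
* **`restrictAlong_ofPullback`** — for a commuting square `ι ≫ q = q' ≫ κ` compatible with the actions, `squareIso : ι^* q^* F ≅
  q'^* κ^* F` intertwines the restriction of `ofPullback ρ F` with `ofPullback τ (κ^* F)` («the canonical linearisation
  restricts to the canonical linearisation»);
* `ActionOver.compBase`, **`ofPullback_compBase`** — `(q' ≫ κ)^* F ≅ q'^* κ^* F` intertwines `ofPullback (τ.compBase κ) F`
  with `ofPullback τ (κ^* F)`.
All for `F` finite locally free (frame argument of part I). -- TODO(general form): every `𝒪`-module `F`.

## References

* [MumfordFogartyKirwan1994] D. Mumford, J. Fogarty, F. Kirwan, *Geometric Invariant Theory*, 3rd ed., Ch. 1 §3 Def. 1.6 (p. 30).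
* [MumfordAV1970] D. Mumford, *Abelian Varieties* (1970), §7 Prop. 2 (descent data of an inverse image), §8 pp. 78–80.
* [Hartshorne1977] R. Hartshorne, *Algebraic Geometry*, II.5 (p. 110).
-/

noncomputable section

-- `TopCat.Presheaf`/`Scheme.Modules` are not reducible (as in Mathlib's `AlgebraicGeometry/Modules`).
set_option backward.isDefEq.respectTransparency false

open CategoryTheory AlgebraicGeometry Opposite TopologicalSpace

universe u

namespace Literature.AlgebraicGeometry.RelativeSpec

open Literature.AlgebraicGeometry.Modules Literature.AlgebraicGeometry.Motives
open Literature.AlgebraicGeometry.HodgeTheory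

section UnitSectionFormulas

variable {X Y Z : Scheme.{u}}

/-- `pullbackComp⁻¹` sends `η_{g ≫ f}(m)` to `η_g(η_f(m))` (★ `pullbackComp_inv_app_unitSection`, with the open spelled
`(g ≫ f)⁻¹ V`). [cite: Hartshorne1977, II.5 (p. 110)] -/
theorem pullbackComp_inv_app_unitSection' (g : X ⟶ Y) (f : Y ⟶ Z) (M : Z.Modules) (V : Z.Opens) (m : Γ(M, V)) :
    ((Scheme.Modules.pullbackComp g f).inv.app M).app ((g ≫ f) ⁻¹ᵁ V) (unitSection (g ≫ f) M V m) =
      unitSection g ((Scheme.Modules.pullback f).obj M) (f ⁻¹ᵁ V) (unitSection f M V m) :=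
  pullbackComp_inv_app_unitSection f M g V m

end UnitSectionFormulas

/-! ### §5 Restriction of intertwiners and of the canonical linearisation of an inverse image -/

section OfIso

variable {X Y S Y' : Scheme.{u}} {r : X ⟶ Y} {r' : S ⟶ Y'} {G : Type*} [Group G]
  (ρ : ActionOver r G) (τ : ActionOver r' G) (ι : S ⟶ X) (hι : ∀ g : G, τ.autHom g ≫ ι = ι ≫ ρ.autHom g)

/-- **Restriction along `ι` commutes with conjugation by an isomorphism of modules**:
`R_g(σ_g^*(e⁻¹) ≫ ψ ≫ e) = τ_g^*(ι^*e)⁻¹ ≫ R_g(ψ) ≫ ι^*e` (naturality of `squareIso`). So `ι^*e` intertwines the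
restrictions of two linearisations intertwined by `e`. [cite: MumfordFogartyKirwan1994, Ch. 1 §3 Definition 1.6 (p. 30)] -/
theorem restrictAlong_conj {E E' : X.Modules} (e : E ≅ E') (g : G) (ψ : (Scheme.Modules.pullback (ρ.autHom g)).obj E ⟶ E) :
    restrictAlong ρ τ ι hι E' g ((Scheme.Modules.pullback (ρ.autHom g)).map e.inv ≫ ψ ≫ e.hom) =
      (Scheme.Modules.pullback (τ.autHom g)).map ((Scheme.Modules.pullback ι).map e.inv) ≫
        restrictAlong ρ τ ι hι E g ψ ≫ (Scheme.Modules.pullback ι).map e.hom := by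
  simp only [restrictAlong, Functor.map_comp, Category.assoc]
  rw [squareIso_hom_naturality_assoc]

/-- `ofIso` and `restrict` commute: the structure isomorphisms of `(Φ.ofIso e).restrict` are those of
`(Φ.restrict).ofIso (ι^* e)`. [cite: MumfordFogartyKirwan1994, Ch. 1 §3 Definition 1.6 (p. 30)] -/
theorem ActionOver.EquivariantStructure.restrict_ofIso_iso_hom {E E' : X.Modules} (hE : IsFiniteLocallyFree E)
    (hE' : IsFiniteLocallyFree E') (Φ : ρ.EquivariantStructure E) (e : E ≅ E') (g : G) :
    (((Φ.ofIso e).restrict τ ι hι hE').iso g).hom =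
      (((Φ.restrict τ ι hι hE).ofIso ((Scheme.Modules.pullback ι).mapIso e)).iso g).hom := by
  simp only [ActionOver.EquivariantStructure.restrict_iso_hom, ActionOver.EquivariantStructure.ofIso, Iso.trans_hom,
    Functor.mapIso_hom, Functor.mapIso_inv, Iso.symm_hom, ActionOver.EquivariantStructure.restrict_iso_hom]
  exact restrictAlong_conj ρ τ ι hι e g (Φ.iso g).hom

end OfIso

section OfPullback

variable {X S Q Q' : Scheme.{u}} {q : X ⟶ Q} {q' : S ⟶ Q'} {G : Type*} [Group G]
  (ρ : ActionOver q G) (τ : ActionOver q' G) (ι : S ⟶ X) (κ : Q' ⟶ Q) (hsq : ι ≫ q = q' ≫ κ)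
  (hι : ∀ g : G, τ.autHom g ≫ ι = ι ≫ ρ.autHom g)

/-- The canonical linearisation of an inverse image on pulled-back sections: `(ofPullback ρ F).iso g` sends
`η_{σ_g}(η_q(m))` to `η_q(m)` (transported along `σ_g⁻¹ q⁻¹ V = q⁻¹ V`). [cite: MumfordAV1970, §7 (Prop. 2)] -/
theorem ofPullback_iso_hom_app_unitSection (F : Q.Modules) (g : G) (V : Q.Opens) (m : Γ(F, V)) :
    ((ActionOver.EquivariantStructure.ofPullback ρ F).iso g).hom.app (ρ.autHom g ⁻¹ᵁ (q ⁻¹ᵁ V))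
        (unitSection (ρ.autHom g) ((Scheme.Modules.pullback q).obj F) (q ⁻¹ᵁ V) (unitSection q F V m)) =
      ((Scheme.Modules.pullback q).obj F).presheaf.map (eqToHom (ρ.preimage_preimage g V)).op
        (unitSection q F V m) := by
  simp only [ActionOver.EquivariantStructure.ofPullback, Iso.trans_hom, Iso.app_hom, Scheme.Modules.Hom.comp_app,
    CategoryTheory.comp_apply]
  erw [pullbackComp_hom_app_unitSection (ρ.autHom g) q F V m]
  exact (pullbackCongr_hom_app_unitSection F (ρ.autHom_comp g) V m).trans (presheaf_map_congr _ _ _ _)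

/-- **The canonical linearisation restricts to the canonical linearisation**: for a commuting square `ι ≫ q = q' ≫ κ`
compatible with the actions (`τ_g ≫ ι = ι ≫ σ_g`), the comparison `squareIso : ι^* q^* F ≅ q'^* κ^* F` intertwines the
restriction along `ι` of `ofPullback ρ F` with `ofPullback τ (κ^* F)` (for `F` finite locally free).
[cite: MumfordAV1970, §7 (Prop. 2)] [cite: MumfordFogartyKirwan1994, Ch. 1 §3 Definition 1.6 (p. 30)] -/
theorem restrictAlong_ofPullback {F : Q.Modules} (hF : IsFiniteLocallyFree F) (g : G) :
    restrictAlong ρ τ ι hι ((Scheme.Modules.pullback q).obj F) g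
        ((ActionOver.EquivariantStructure.ofPullback ρ F).iso g).hom ≫ (squareIso hsq F).hom =
      (Scheme.Modules.pullback (τ.autHom g)).map (squareIso hsq F).hom ≫
        ((ActionOver.EquivariantStructure.ofPullback τ ((Scheme.Modules.pullback κ).obj F)).iso g).hom := by
  classical
  let Fr := frameSystemOfIsFiniteLocallyFree hF
  letI : ∀ x, Fintype (Fr.I x) := fun x => Fintype.ofEquiv _ (Fr.enum x).symm
  letI : ∀ x, Fintype (TrivIndex hF x) := fun x => Fintype.ofEquiv _ (Fr.enum x).symm
  refine pullback_hom_ext_of_frames (τ.autHom g) (fun x => ι ⁻¹ᵁ (q ⁻¹ᵁ Fr.U x))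
    (fun s => ⟨q.base (ι.base s), Fr.mem _⟩) (fun x => pullbackFrame ι (pullbackFrame q (Fr.frame x))) fun x i => ?_
  set b := basisSection (Fr.frame x) i
  rw [basisSection_pullbackFrame, basisSection_pullbackFrame]
  -- left-hand side
  rw [Scheme.Modules.Hom.comp_app, CategoryTheory.comp_apply, restrictAlong_app_unitSection,
    ofPullback_iso_hom_app_unitSection, unitSection_map, Scheme.Modules.Hom.app_map_apply,
    Scheme.Modules.Hom.app_map_apply, squareIso_hom_app_unitSection]
  -- right-hand side
  rw [Scheme.Modules.Hom.comp_app, CategoryTheory.comp_apply,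
    pullback_map_app_unitSection (τ.autHom g) (squareIso hsq F).hom, squareIso_hom_app_unitSection, unitSection_map,
    Scheme.Modules.Hom.app_map_apply]
  erw [ofPullback_iso_hom_app_unitSection τ ((Scheme.Modules.pullback κ).obj F) g (κ ⁻¹ᵁ Fr.U x)
    (unitSection κ F (Fr.U x) b)]
  simp only [← CategoryTheory.comp_apply, ← Functor.map_comp]
  exact presheaf_map_congr _ _ _ _

end OfPullback

section Rebase

variable {S Q Q' : Scheme.{u}} {q' : S ⟶ Q'} {G : Type*} [Group G] (τ : ActionOver q' G) (κ : Q' ⟶ Q)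

/-- The same automorphisms, viewed as an action over the composite base `q' ≫ κ`. Plumbing.
[cite: MumfordFogartyKirwan1994, Ch. 1 §3 Definition 1.6 (p. 30)] -/
abbrev ActionOver.compBase : ActionOver (q' ≫ κ) G :=
  ⟨τ.aut, fun g => by rw [← Category.assoc, τ.aut_comp]⟩

/-- `compBase` does not change the automorphisms. [cite: MumfordFogartyKirwan1994, Ch. 1 §3 Definition 1.6 (p. 30)] -/
@[simp]
theorem ActionOver.compBase_aut : (τ.compBase κ).aut = τ.aut := rfl

/-- **Re-basing the canonical linearisation along a composite**: `(q' ≫ κ)^* F ≅ q'^* κ^* F` (`pullbackComp⁻¹`)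
intertwines `ofPullback (τ.compBase κ) F` with `ofPullback τ (κ^* F)` (for `F` finite locally free).
[cite: MumfordAV1970, §7 (Prop. 2)] -/
theorem ofPullback_compBase {F : Q.Modules} (hF : IsFiniteLocallyFree F) (g : G) :
    ((ActionOver.EquivariantStructure.ofPullback (τ.compBase κ) F).iso g).hom ≫
        (Scheme.Modules.pullbackComp q' κ).inv.app F =
      (Scheme.Modules.pullback (τ.autHom g)).map ((Scheme.Modules.pullbackComp q' κ).inv.app F) ≫
        ((ActionOver.EquivariantStructure.ofPullback τ ((Scheme.Modules.pullback κ).obj F)).iso g).hom := by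
  classical
  let Fr := frameSystemOfIsFiniteLocallyFree hF
  letI : ∀ x, Fintype (Fr.I x) := fun x => Fintype.ofEquiv _ (Fr.enum x).symm
  refine pullback_hom_ext_of_frames (τ.autHom g) (fun x => (q' ≫ κ) ⁻¹ᵁ Fr.U x)
    (fun s => ⟨(q' ≫ κ).base s, Fr.mem _⟩) (fun x => pullbackFrame (q' ≫ κ) (Fr.frame x)) fun x i => ?_
  set b := basisSection (Fr.frame x) i
  rw [basisSection_pullbackFrame]
  -- left-hand side
  rw [Scheme.Modules.Hom.comp_app, CategoryTheory.comp_apply, ofPullback_iso_hom_app_unitSection (τ.compBase κ) F g (Fr.U x) b,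
    Scheme.Modules.Hom.app_map_apply, pullbackComp_inv_app_unitSection']
  -- right-hand side
  rw [Scheme.Modules.Hom.comp_app, CategoryTheory.comp_apply,
    pullback_map_app_unitSection (τ.autHom g) ((Scheme.Modules.pullbackComp q' κ).inv.app F) ((q' ≫ κ) ⁻¹ᵁ Fr.U x)
      (unitSection (q' ≫ κ) F (Fr.U x) b), pullbackComp_inv_app_unitSection']
  have h6 : ((ActionOver.EquivariantStructure.ofPullback τ ((Scheme.Modules.pullback κ).obj F)).iso g).hom.app
      (τ.autHom g ⁻¹ᵁ ((q' ≫ κ) ⁻¹ᵁ Fr.U x))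
      (unitSection (τ.autHom g) ((Scheme.Modules.pullback q').obj ((Scheme.Modules.pullback κ).obj F))
        ((q' ≫ κ) ⁻¹ᵁ Fr.U x) (unitSection q' ((Scheme.Modules.pullback κ).obj F) (κ ⁻¹ᵁ Fr.U x)
          (unitSection κ F (Fr.U x) b))) =
      ((Scheme.Modules.pullback q').obj ((Scheme.Modules.pullback κ).obj F)).presheaf.map
        (eqToHom (τ.preimage_preimage g (κ ⁻¹ᵁ Fr.U x))).op
        (unitSection q' ((Scheme.Modules.pullback κ).obj F) (κ ⁻¹ᵁ Fr.U x) (unitSection κ F (Fr.U x) b)) :=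
    ofPullback_iso_hom_app_unitSection τ ((Scheme.Modules.pullback κ).obj F) g (κ ⁻¹ᵁ Fr.U x) (unitSection κ F (Fr.U x) b)
  exact (presheaf_map_congr _ _ _ _).trans h6.symm

end Rebase

end Literature.AlgebraicGeometry.RelativeSpec

end
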